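import Summits.QuantumFields.YangMills.Theorems.LuscherReductionTwistedTraceScalingBTFibreProfile
import HarnessLib

/-!
# (B-ST) step (S4a), first brick of «PiDensity»: the fibre measure of a set is the a-priori measure of a SLAB of the tube over any slow window —
# `σ^{⊗3}(B) · π(A) = σ^{⊗E}{orthoTube u⁻¹ v : u ∈ B, v ∈ A ∩ cap}`
# (lane A of S-BASE, crux `TwistedTraceScaling` stmt-QuantumFields-20203, C4-CORE, the (B-ST) pen; HANDOFF-g21 finding 2 / (S4))

The one geometric input of the (B-ST) Poincaré route is a two-sided LEBESGUE-density bound for `π = orthoTransverse L` near `0` (β-independent).  `π` is defined abstractly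
(`slowMarginal` of the equivariant orthographic chart); `…BTFibreProfile.orthoTransverse_apply` expresses `π(A)` through the WHOLE slab `Set.univ ×ˢ A`, which leaves every chart of
`SU(2)^E`.  This file localises the slow window: for every measurable `B ⊆ SU(2)³` and measurable `A`,
★★ `configMeasure_one_mul_orthoTransverse` — `configMeasure SU2 1 B * orthoTransverse L A = configMeasure SU2 L (orthoSlab B A)`, `orthoSlab B A = {orthoTube L u⁻¹ v | u ∈ B, v ∈ A ∩ capBalancedSet}`
(`slowMeasure_prod` + `slowMeasure_apply` of `…SlowDisintegration`), hence ★ `orthoTransverse_eq_div` — `π(A) = σ^{⊗E}(orthoSlab B A)/σ^{⊗3}(B)` for `σ^{⊗3}(B) ≠ 0`: with `B` a small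
ball at `1` the slab lies in the global gnomonic chart at the vacuum, where `σ^{⊗E}` has the two-sided density `latGnDensityReal` and the slab is the image of `B × A` under an explicit
`C¹` local diffeomorphism (`orthoTube_one_eq_latPatternChart`) — the Jacobian step (Mathlib `lintegral_abs_det_fderiv_eq_addHaar_image`) is the next file.
HONEST FRAMING: measure bookkeeping for a stub of a child of the CONDITIONAL route R2b1; (B-ST) OPEN; C4-CORE OPEN; not infinite volume, not a gap, not Clay.
-/

set_option autoImplicit false

noncomputable section

open MeasureTheory Filter Topology Real
open scoped BigOperators
open Literature.MathematicalPhysics.QuantumFieldTheory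
open Literature.MathematicalPhysics.QuantumLattice

namespace Summit.QuantumFields.YangMills.Theorems.FemtoTransferGap.TwoLattice.ConstTube

open Summit.QuantumFields.YangMills.Theorems.FemtoTransferGap
open Summit.QuantumFields.YangMills.Theorems.FemtoTransferGap.TwoLattice.SlowChart

variable (L : ℕ) [NeZero L]

/-- ★★ **Slab identity**: `σ^{⊗3}(B)·π(A) = σ^{⊗E}(slowEmb (orthoChart L) '' (B ×ˢ (val⁻¹' A)))`, i.e. the a-priori measure of `{orthoTube L u⁻¹ v : u ∈ B, v ∈ A ∩ cap}`, for measurable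
`B ⊆ SU(2)³` and measurable `A`. [folklore] -/
theorem configMeasure_one_mul_orthoTransverse {B : Set (GaugeConfig 3 1 SU2)} (hB : MeasurableSet B) {A : Set (Edge 3 L → Fin 3 → ℝ)} (hA : MeasurableSet A) :
    configMeasure SU2 1 B * orthoTransverse L A = configMeasure SU2 L (slowEmb (orthoChart L) '' (B ×ˢ (Subtype.val ⁻¹' A))) := by
  haveI : PolishSpace (capBalancedSet L) := (isClosed_capBalancedSet L).polishSpace
  unfold orthoTransverse
  rw [Measure.map_apply measurable_subtype_coe hA, ← slowMeasure_prod (continuous_orthoChart L) (orthoChart_injective L) (orthoChart_mul L) hB (measurable_subtype_coe hA),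
    slowMeasure_apply (continuous_orthoChart L) (orthoChart_injective L)]

/-- The slab, pointwise: `U ∈ slowEmb '' (B ×ˢ val⁻¹'A)` iff `U = orthoTube L u⁻¹ v` with `u ∈ B`, `v ∈ A ∩ capBalancedSet`. [folklore] -/
theorem mem_orthoSlab_iff (B : Set (GaugeConfig 3 1 SU2)) (A : Set (Edge 3 L → Fin 3 → ℝ)) (U : GaugeConfig 3 L SU2) :
    U ∈ slowEmb (orthoChart L) '' (B ×ˢ (Subtype.val ⁻¹' A)) ↔ ∃ u ∈ B, ∃ v ∈ A ∩ capBalancedSet L, U = orthoTube L u⁻¹ v := by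
  constructor
  · rintro ⟨⟨u, v⟩, ⟨hu, hv⟩, rfl⟩
    exact ⟨u, hu, v, ⟨hv, v.2⟩, rfl⟩
  · rintro ⟨u, hu, v, ⟨hvA, hvc⟩, rfl⟩
    exact ⟨(u, ⟨v, hvc⟩), ⟨hu, hvA⟩, rfl⟩

/-- ★ **`π(A) = σ^{⊗E}(slab)/σ^{⊗3}(B)`** for every measurable slow window `B` of non-zero measure — the localisation that puts the fibre measure inside ONE chart of `SU(2)^E`.
[folklore] -/
theorem orthoTransverse_eq_div {B : Set (GaugeConfig 3 1 SU2)} (hB : MeasurableSet B) (hB0 : configMeasure SU2 1 B ≠ 0) {A : Set (Edge 3 L → Fin 3 → ℝ)} (hA : MeasurableSet A) :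
    orthoTransverse L A = configMeasure SU2 L (slowEmb (orthoChart L) '' (B ×ˢ (Subtype.val ⁻¹' A))) / configMeasure SU2 1 B := by
  have h := configMeasure_one_mul_orthoTransverse L hB hA
  have hBtop : configMeasure SU2 1 B ≠ ⊤ := measure_ne_top _ _
  rw [← h, mul_comm, ENNReal.mul_div_cancel_right hB0 hBtop]

/-- In real numbers: `π.real(A) = σ^{⊗E}.real(slab)/σ^{⊗3}.real(B)`. [folklore] -/
theorem orthoTransverse_real_eq_div {B : Set (GaugeConfig 3 1 SU2)} (hB : MeasurableSet B) (hB0 : configMeasure SU2 1 B ≠ 0) {A : Set (Edge 3 L → Fin 3 → ℝ)} (hA : MeasurableSet A) :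
    (orthoTransverse L).real A = (configMeasure SU2 L).real (slowEmb (orthoChart L) '' (B ×ˢ (Subtype.val ⁻¹' A))) / (configMeasure SU2 1).real B := by
  simp only [Measure.real]
  rw [orthoTransverse_eq_div L hB hB0 hA, ENNReal.toReal_div]

end Summit.QuantumFields.YangMills.Theorems.FemtoTransferGap.TwoLattice.ConstTube

end
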